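import Literature.MathematicalPhysics.KineticTheory.HardSphereUniformGas
import Literature.Analysis.FluidPDE.HardSphereTimeScaling
import Summits.AtomisticToContinuum.HydrodynamicLimit.Theorems.KineticWindowGronwall.Negative.ActivityDummy
import HarnessLib

/-!
# Thermal scaling of the homogeneous local Gibbs law (helper, layer 3: statics)

Crux `Summit.AtomisticToContinuum.HydrodynamicLimit.Theses.AntiMazurCoboundaries.KineticWindowGronwall`
(stmt-AtomisticToContinuum-9282), line `dlr-block-transfer` v4, helper toward the lead's stub `stub_blockTransfer`
(proof-plan step (1): "thermal scaling `(x, t) ↦ (x, t√θ)`, `v ↦ v/√θ` reduces every use of the kinetic hypothesis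
to the frame `θ = 1`") and toward the shared crux stmt-10967 (`∀ θ` ⇐ `θ = 1`). Layers 1–2
(`…KineticWindowGronwallThermalScalingTrajectory`, `…ThermalScalingFlow`: registered stubs
`stub_trajectoryThermalScaling`, `stub_flowThermalScaling`) transport TRAJECTORIES and FLOWS under the time–velocity
rescaling `scaleVel c`, `t ↦ t/c`; this self-contained file transports the INITIAL LAW: the homogeneous
(constant-profile) local Gibbs law `G_N(a, u, θ) = localGibbsLaw σ (fun _ => a) (fun _ => u) (fun _ => θ) N Φ` of
`HardSphereEuler` (which depends on the flow `Φ` only through its type).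

THE IDENTITY. `(scaleVel c)_# G_N(a, u, θ) = G_N(a, c u, c² θ)` for every activity `a`, `θ > 0`, `c > 0`
(`localGibbsLaw_const_map_scaleVel`); at the THERMAL value `c = (√θ)⁻¹` the temperature-`θ` law is carried to the
temperature-`1` law (`localGibbsLaw_const_map_scaleVel_thermal`, registered helper stub
`stub_localGibbsLawThermalScaling : LocalGibbsLawThermalScaling`, stated at `u = 0` with an arbitrary type-fixing
target flow `Ψ` — e.g. the rescaled flow `thermalScale Φ (√θ)⁻¹ _` of layer 2). PROOF: by the rung-0 product structure
`localGibbsMeasure_rung0_eq_map` (`HardSphereUniformGas`) the law is `zipConfig_# (posGibbs ⊗ ⊗ᵢ N(u, θ))` for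
`a ≥ 0`; `scaleVel c ∘ zipConfig = zipConfig ∘ (id × (v ↦ c v))`, the position factor is untouched and the isotropic
Gaussian `N(u, θ) = (w ↦ u + √θ w)_# N(0, 1)` is mapped by `v ↦ c v` to `N(c u, c² θ)` (`gaussMeasure_map_smul`,
`√(c² θ) = c √θ`); a non-zero activity cancels from the canonical density (`localGibbsLaw_const_activity` of
`Theorems/KineticWindowGronwall/Negative/ActivityDummy`), which covers `a < 0`. Consequence for window
functionals: `∫⁻ F dG_N(a, (√θ)⁻¹ u, 1) = ∫⁻ F ∘ scaleVel (√θ)⁻¹ dG_N(a, u, θ)` (`lintegral_localGibbsLaw_thermal`).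
-/

noncomputable section

open Set Function MeasureTheory ProbabilityTheory
open scoped ENNReal
open Literature.Analysis.FluidPDE Literature.MathematicalPhysics.KineticTheory

namespace Summit.AtomisticToContinuum.HydrodynamicLimit.Theorems.KineticWindowGronwallThermalScaling

/-! ### Gaussian velocities under `v ↦ c v` -/

section Gauss

variable {E : Type*} [NormedAddCommGroup E] [InnerProductSpace ℝ E] [FiniteDimensional ℝ E]
  [MeasurableSpace E] [BorelSpace E]

/-- **Scaling an isotropic Gaussian**: the image of `N(u, θ id)` under `v ↦ c v` is `N(c u, c² θ id)` (`c ≥ 0`;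
both are affine images of the standard Gaussian, and `√(c² θ) = c √θ`). [folklore] -/
theorem gaussMeasure_map_smul (u : E) (θ : ℝ) {c : ℝ} (hc : 0 ≤ c) :
    (gaussMeasure u θ).map (fun v => c • v) = gaussMeasure (c • u) (c ^ 2 * θ) := by
  rw [gaussMeasure, gaussMeasure, Measure.map_map (measurable_const_smul c) (measurable_gaussShift u θ)]
  congr 1
  funext w
  simp only [comp_apply, smul_add, smul_smul, Real.sqrt_mul (sq_nonneg c), Real.sqrt_sq hc]

/-- The same for i.i.d. families: `(⊗ᵢ N(u, θ))` is mapped by `v ↦ (c vᵢ)ᵢ` to `⊗ᵢ N(c u, c² θ)`. [folklore] -/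
theorem pi_gaussMeasure_map_smul (n : ℕ) (u : E) (θ : ℝ) {c : ℝ} (hc : 0 ≤ c) :
    (Measure.pi fun _ : Fin n => gaussMeasure u θ).map (fun v i => c • v i) =
      Measure.pi fun _ : Fin n => gaussMeasure (c • u) (c ^ 2 * θ) :=
  (measurePreserving_pi (fun _ : Fin n => gaussMeasure u θ) (fun _ : Fin n => gaussMeasure (c • u) (c ^ 2 * θ))
    fun _ => ⟨measurable_const_smul c, gaussMeasure_map_smul u θ hc⟩).map_eq

end Gauss

/-! ### The homogeneous local Gibbs law under `scaleVel c` -/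

section Gibbs

variable {N : ℕ}

/-- `scaleVel c` acts on a zipped configuration by scaling the velocity block. [folklore] -/
theorem scaleVel_zipConfig (c : ℝ) (p : (Fin N → T3) × (Fin N → V3)) :
    scaleVel c (zipConfig p) = zipConfig (p.1, fun i => c • p.2 i) := by
  funext i
  rfl

/-- As maps: `scaleVel c ∘ zipConfig = zipConfig ∘ Prod.map id (v ↦ (c vᵢ)ᵢ)`. [folklore] -/
theorem scaleVel_comp_zipConfig (c : ℝ) :
    (scaleVel c ∘ zipConfig : (Fin N → T3) × (Fin N → V3) → Config N (Fin 3) T3) =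
      zipConfig ∘ Prod.map id (fun v i => c • v i) := by
  funext p
  exact scaleVel_zipConfig c p

/-- `scaleVel c` is measurable on the torus phase space. [folklore] -/
theorem measurable_scaleVel_torus (c : ℝ) : Measurable (scaleVel c : Config N (Fin 3) T3 → Config N (Fin 3) T3) :=
  measurable_pi_lambda _ fun i => (measurable_pi_apply i).fst.prodMk ((measurable_pi_apply i).snd.const_smul c)

/-- `scaleVel c`, `c ≠ 0`, is a measurable embedding of the torus phase space (a measurable automorphism with inverse
`scaleVel c⁻¹`; cf. layer 2's `scaleVelEquiv`). [folklore] -/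
theorem measurableEmbedding_scaleVel_torus {c : ℝ} (hc : c ≠ 0) :
    MeasurableEmbedding (scaleVel c : Config N (Fin 3) T3 → Config N (Fin 3) T3) :=
  MeasurableEquiv.measurableEmbedding
    { toFun := scaleVel c
      invFun := scaleVel c⁻¹
      left_inv := scaleVel_inv_scaleVel hc
      right_inv := fun z => by rw [scaleVel_scaleVel, mul_inv_cancel₀ hc, scaleVel_one]
      measurable_toFun := measurable_scaleVel_torus c
      measurable_invFun := measurable_scaleVel_torus c⁻¹ }

/-- **Window functionals along a conjugated flow** (any geometry): if `Ψ_t = scaleVel c ∘ Φ_{ct} ∘ scaleVel c⁻¹`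
pointwise (the formula of layer 2's `FlowThermalScaling`), then for every observable `F` and `c ≠ 0`,
`∫_a^b F (Ψ_s (scaleVel c z)) ds = c⁻¹ ∫_{ca}^{cb} F (scaleVel c (Φ_s z)) ds`. [folklore] -/
theorem intervalIntegral_conj_flow {d : Type*} [Fintype d] {X : Type*} [MeasureSpace X] [TopologicalSpace X]
    {G : Geometry d X} {ε : ℝ} {n : ℕ} (Φ Ψ : HardSphereFlow G ε n) {c : ℝ} (hc : c ≠ 0)
    (hΨ : ∀ t z, Ψ.flow t z = scaleVel c (Φ.flow (c * t) (scaleVel c⁻¹ z)))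
    {E : Type*} [NormedAddCommGroup E] [NormedSpace ℝ E] (F : Config n d X → E) (z : Config n d X) (a b : ℝ) :
    ∫ s in a..b, F (Ψ.flow s (scaleVel c z)) = c⁻¹ • ∫ s in (c * a)..(c * b), F (scaleVel c (Φ.flow s z)) := by
  simp only [hΨ, scaleVel_inv_scaleVel hc]
  exact intervalIntegral.integral_comp_mul_left (fun s => F (scaleVel c (Φ.flow s z))) hc

/-- **The flow-free homogeneous local Gibbs measure under `scaleVel c`** (`a ≥ 0`, `θ > 0`, `c > 0`):
`(scaleVel c)_# G_N(a, u, θ) = G_N(a, c u, c² θ)` — positions and their Gibbs factor are untouched, the i.i.d.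
Maxwellian velocities `N(u, θ)` become `N(c u, c² θ)` (rung-0 product structure `localGibbsMeasure_rung0_eq_map`).
[folklore] -/
theorem localGibbsMeasure_const_map_scaleVel (σ : ℝ) {a θ c : ℝ} (ha : 0 ≤ a) (hθ : 0 < θ) (hc : 0 < c) (u : V3)
    (N : ℕ) :
    (localGibbsMeasure σ (fun _ => a) (fun _ => u) (fun _ => θ) N).map (scaleVel c) =
      localGibbsMeasure σ (fun _ => a) (fun _ => c • u) (fun _ => c ^ 2 * θ) N := by
  have hθ' : 0 < c ^ 2 * θ := mul_pos (pow_pos hc 2) hθ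
  haveI : SigmaFinite (posGibbsMeasure (fun _ : T3 => a) (hsDiameter σ N) (N + 1)) := by
    unfold posGibbsMeasure; infer_instance
  have hvel : MeasurePreserving (fun (v : Fin (N + 1) → V3) i => c • v i)
      (Measure.pi fun _ : Fin (N + 1) => gaussMeasure u θ)
      (Measure.pi fun _ : Fin (N + 1) => gaussMeasure (c • u) (c ^ 2 * θ)) :=
    measurePreserving_pi _ _ fun _ => ⟨measurable_const_smul c, gaussMeasure_map_smul u θ hc.le⟩
  have hprod := (MeasurePreserving.id (posGibbsMeasure (fun _ : T3 => a) (hsDiameter σ N) (N + 1))).prod hvel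
  rw [localGibbsMeasure_rung0_eq_map σ ha hθ u N, localGibbsMeasure_rung0_eq_map σ ha hθ' (c • u) N,
    Measure.map_map (measurable_scaleVel_torus c) measurable_zipConfig, scaleVel_comp_zipConfig,
    ← Measure.map_map measurable_zipConfig (measurable_id.prodMap hvel.measurable), ← hprod.map_eq]

/-- For the zero activity the local Gibbs law is the zero measure (the canonical density of the zero profile
vanishes identically). [folklore] -/
theorem localGibbsLaw_zero_activity (σ θ : ℝ) (u : V3) (N : ℕ)
    (Φ : HardSphereFlow (Torus.geometry (Fin 3)) (hsDiameter σ N) (N + 1)) :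
    localGibbsLaw σ (fun _ => (0 : ℝ)) (fun _ => u) (fun _ => θ) N Φ = 0 := by
  have hprof : localGibbsProfile (fun _ => (0 : ℝ)) (fun _ => u) (fun _ => θ) = fun _ => 0 := by
    funext y
    simp [localGibbsProfile]
  have hdens : (fun z : Config (N + 1) (Fin 3) T3 => ENNReal.ofReal
      (canonicalDensity (Torus.geometry (Fin 3)) (hsDiameter σ N) (N + 1) (fun _ => (0 : ℝ)) z)) = 0 := by
    funext z
    have htp : tensorPow (N + 1) (fun _ : T3 × V3 => (0 : ℝ)) = 0 := by
      funext w
      simp [tensorPow]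
    simp [canonicalDensity, htp]
  rw [localGibbsLaw, particleLaw_eq, hprof, hdens, withDensity_zero]

/-- **THE HOMOGENEOUS LOCAL GIBBS LAW UNDER `scaleVel c`** (every activity `a`, `θ > 0`, `c > 0`, any bulk velocity
`u`, any type-fixing flows `Φ, Ψ`): `(scaleVel c)_# G_N(a, u, θ) = G_N(a, c u, c² θ)`. For `a ≠ 0` the activity cancels
from the canonical density (reduction to `a = 1 ≥ 0`), for `a = 0` both sides vanish. [folklore] -/
theorem localGibbsLaw_const_map_scaleVel (σ a : ℝ) {θ c : ℝ} (hθ : 0 < θ) (hc : 0 < c) (u : V3) (N : ℕ)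
    (Φ Ψ : HardSphereFlow (Torus.geometry (Fin 3)) (hsDiameter σ N) (N + 1)) :
    (localGibbsLaw σ (fun _ => a) (fun _ => u) (fun _ => θ) N Φ).map (scaleVel c) =
      localGibbsLaw σ (fun _ => a) (fun _ => c • u) (fun _ => c ^ 2 * θ) N Ψ := by
  rcases le_or_gt 0 a with ha | ha
  · rw [localGibbsLaw_eq, localGibbsLaw_eq, localGibbsMeasure_const_map_scaleVel σ ha hθ hc u N]
  · rw [KineticWindowGronwallNegative.localGibbsLaw_const_activity ha.ne,
      KineticWindowGronwallNegative.localGibbsLaw_const_activity ha.ne, localGibbsLaw_eq, localGibbsLaw_eq,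
      localGibbsMeasure_const_map_scaleVel σ zero_le_one hθ hc u N]

/-! ### The thermal value `c = (√θ)⁻¹` -/

/-- `((√θ)⁻¹)² θ = 1` for `θ > 0`. [folklore] -/
theorem inv_sqrt_sq_mul {θ : ℝ} (hθ : 0 < θ) : (Real.sqrt θ)⁻¹ ^ 2 * θ = 1 := by
  rw [inv_pow, Real.sq_sqrt hθ.le, inv_mul_cancel₀ hθ.ne']

/-- **THERMAL RESCALING OF THE HOMOGENEOUS LOCAL GIBBS LAW TO UNIT TEMPERATURE**:
`(scaleVel (√θ)⁻¹)_# G_N(a, u, θ) = G_N(a, (√θ)⁻¹ u, 1)` (every `a`, `θ > 0`, any type-fixing flows). [folklore] -/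
theorem localGibbsLaw_const_map_scaleVel_thermal (σ a : ℝ) {θ : ℝ} (hθ : 0 < θ) (u : V3) (N : ℕ)
    (Φ Ψ : HardSphereFlow (Torus.geometry (Fin 3)) (hsDiameter σ N) (N + 1)) :
    (localGibbsLaw σ (fun _ => a) (fun _ => u) (fun _ => θ) N Φ).map (scaleVel (Real.sqrt θ)⁻¹) =
      localGibbsLaw σ (fun _ => a) (fun _ => (Real.sqrt θ)⁻¹ • u) (fun _ => (1 : ℝ)) N Ψ := by
  have h := localGibbsLaw_const_map_scaleVel σ a hθ (inv_pos.2 (Real.sqrt_pos.2 hθ)) u N Φ Ψ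
  rwa [inv_sqrt_sq_mul hθ] at h

/-- The centred case `u = 0`: `(scaleVel (√θ)⁻¹)_# G_N(a, 0, θ) = G_N(a, 0, 1)`. [folklore] -/
theorem localGibbsLaw_const_map_scaleVel_thermal_zero (σ a : ℝ) {θ : ℝ} (hθ : 0 < θ) (N : ℕ)
    (Φ Ψ : HardSphereFlow (Torus.geometry (Fin 3)) (hsDiameter σ N) (N + 1)) :
    (localGibbsLaw σ (fun _ => a) (fun _ => (0 : V3)) (fun _ => θ) N Φ).map (scaleVel (Real.sqrt θ)⁻¹) =
      localGibbsLaw σ (fun _ => a) (fun _ => (0 : V3)) (fun _ => (1 : ℝ)) N Ψ := by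
  have h := localGibbsLaw_const_map_scaleVel_thermal σ a hθ 0 N Φ Ψ
  rwa [smul_zero] at h

/-- **Expectations in the unit-temperature frame are rescaled-observable expectations at temperature `θ`**: for
every `F : Config → ℝ≥0∞` (no measurability: `scaleVel` is a measurable embedding),
`∫⁻ F dG_N(a, (√θ)⁻¹ u, 1) = ∫⁻ F (scaleVel (√θ)⁻¹ z) dG_N(a, u, θ)(z)` (e.g. exponential moments of window functionals
of the rescaled flow, layer 2's `intervalIntegral_thermalScale_flow`). [folklore] -/
theorem lintegral_localGibbsLaw_thermal (σ a : ℝ) {θ : ℝ} (hθ : 0 < θ) (u : V3) (N : ℕ)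
    (Φ Ψ : HardSphereFlow (Torus.geometry (Fin 3)) (hsDiameter σ N) (N + 1)) (F : Config (N + 1) (Fin 3) T3 → ℝ≥0∞) :
    ∫⁻ z, F z ∂(localGibbsLaw σ (fun _ => a) (fun _ => (Real.sqrt θ)⁻¹ • u) (fun _ => (1 : ℝ)) N Ψ) =
      ∫⁻ z, F (scaleVel (Real.sqrt θ)⁻¹ z) ∂(localGibbsLaw σ (fun _ => a) (fun _ => u) (fun _ => θ) N Φ) := by
  rw [← localGibbsLaw_const_map_scaleVel_thermal σ a hθ u N Φ Ψ,
    (measurableEmbedding_scaleVel_torus (inv_pos.2 (Real.sqrt_pos.2 hθ)).ne').lintegral_map]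

/-- Masses of measurable sets in the unit-temperature frame: `G_N(a, (√θ)⁻¹ u, 1)(S) = G_N(a, u, θ)(scaleVel (√θ)⁻¹ ⁻¹' S)`.
[folklore] -/
theorem localGibbsLaw_thermal_apply (σ a : ℝ) {θ : ℝ} (hθ : 0 < θ) (u : V3) (N : ℕ)
    (Φ Ψ : HardSphereFlow (Torus.geometry (Fin 3)) (hsDiameter σ N) (N + 1))
    {S : Set (Config (N + 1) (Fin 3) T3)} (hS : MeasurableSet S) :
    localGibbsLaw σ (fun _ => a) (fun _ => (Real.sqrt θ)⁻¹ • u) (fun _ => (1 : ℝ)) N Ψ S =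
      localGibbsLaw σ (fun _ => a) (fun _ => u) (fun _ => θ) N Φ (scaleVel (Real.sqrt θ)⁻¹ ⁻¹' S) := by
  rw [← localGibbsLaw_const_map_scaleVel_thermal σ a hθ u N Φ Ψ, Measure.map_apply (measurable_scaleVel_torus _) hS]

/-- **THE BLOCK-TRANSFER DICTIONARY** (statics + kinematics). Let `Ψ` be conjugated to `Φ` by `scaleVel c`, `c > 0`
(`Ψ_t = scaleVel c ∘ Φ_{ct} ∘ scaleVel c⁻¹`, as provided by layer 2's `FlowThermalScaling`). Then for every
`H : ℝ → ℝ≥0∞` (e.g. `x ↦ exp (β x)`), observable `F` and window `[a', b']`, the `H`-moment of the window functional of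
`Ψ` under `G_N(a, c u, c² θ)` is the `H`-moment of the rescaled window functional of `Φ` under `G_N(a, u, θ)`:
`∫⁻ H (∫_{a'}^{b'} F (Ψ_s z) ds) dG_N(a, c u, c² θ) = ∫⁻ H (c⁻¹ ∫_{ca'}^{cb'} F (scaleVel c (Φ_s z)) ds) dG_N(a, u, θ)`.
No measurability needed (`scaleVel c` is a measurable embedding). [folklore] -/
theorem lintegral_window_conj (σ a : ℝ) {θ c : ℝ} (hθ : 0 < θ) (hc : 0 < c) (u : V3) (N : ℕ)
    (Φ Ψ : HardSphereFlow (Torus.geometry (Fin 3)) (hsDiameter σ N) (N + 1))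
    (hΨ : ∀ t z, Ψ.flow t z = scaleVel c (Φ.flow (c * t) (scaleVel c⁻¹ z)))
    (H : ℝ → ℝ≥0∞) (F : Config (N + 1) (Fin 3) T3 → ℝ) (a' b' : ℝ) :
    ∫⁻ z, H (∫ s in a'..b', F (Ψ.flow s z))
        ∂(localGibbsLaw σ (fun _ => a) (fun _ => c • u) (fun _ => c ^ 2 * θ) N Ψ) =
      ∫⁻ z, H (c⁻¹ * ∫ s in (c * a')..(c * b'), F (scaleVel c (Φ.flow s z)))
        ∂(localGibbsLaw σ (fun _ => a) (fun _ => u) (fun _ => θ) N Φ) := by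
  rw [← localGibbsLaw_const_map_scaleVel σ a hθ hc u N Φ Ψ, (measurableEmbedding_scaleVel_torus hc.ne').lintegral_map]
  refine lintegral_congr fun z => ?_
  rw [intervalIntegral_conj_flow Φ Ψ hc.ne' hΨ F z a' b', smul_eq_mul]

/-- **The thermal dictionary** (`c = (√θ)⁻¹`, centred law): with `Ψ` conjugated to `Φ` by `scaleVel (√θ)⁻¹` (in the
literal form of layer 2's `FlowThermalScaling`), the window-`[a', b']` `H`-moments of `Ψ` under the unit-temperature
law `G_N(a, 0, 1)` are the window-`[a'/√θ, b'/√θ]` `H`-moments of the rescaled observable `F ∘ scaleVel (√θ)⁻¹` of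
`Φ` under `G_N(a, 0, θ)`, time-averaged with the factor `√θ = ((√θ)⁻¹)⁻¹`. [folklore] -/
theorem lintegral_window_thermal (σ a : ℝ) {θ : ℝ} (hθ : 0 < θ) (N : ℕ)
    (Φ Ψ : HardSphereFlow (Torus.geometry (Fin 3)) (hsDiameter σ N) (N + 1))
    (hΨ : ∀ t z, Ψ.flow t z =
      scaleVel (Real.sqrt θ)⁻¹ (Φ.flow ((Real.sqrt θ)⁻¹ * t) (scaleVel (Real.sqrt θ)⁻¹⁻¹ z)))
    (H : ℝ → ℝ≥0∞) (F : Config (N + 1) (Fin 3) T3 → ℝ) (a' b' : ℝ) :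
    ∫⁻ z, H (∫ s in a'..b', F (Ψ.flow s z))
        ∂(localGibbsLaw σ (fun _ => a) (fun _ => (0 : V3)) (fun _ => (1 : ℝ)) N Ψ) =
      ∫⁻ z, H ((Real.sqrt θ)⁻¹⁻¹ * ∫ s in ((Real.sqrt θ)⁻¹ * a')..((Real.sqrt θ)⁻¹ * b'),
          F (scaleVel (Real.sqrt θ)⁻¹ (Φ.flow s z)))
        ∂(localGibbsLaw σ (fun _ => a) (fun _ => (0 : V3)) (fun _ => θ) N Φ) := by
  have h := lintegral_window_conj σ a hθ (inv_pos.2 (Real.sqrt_pos.2 hθ)) 0 N Φ Ψ hΨ H F a' b'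
  rwa [smul_zero, inv_sqrt_sq_mul hθ] at h

end Gibbs

/-! ### The registered statement -/

/-- **THERMAL SCALING OF THE HOMOGENEOUS LOCAL GIBBS LAW.** For every reduced diameter `σ`, activity `a`,
temperature `θ > 0`, particle number `N + 1` and hard-sphere flows `Φ, Ψ` on `𝕋³` of diameter `hsDiameter σ N` (the
flows only fix the phase space; `Ψ` is meant to be the thermally rescaled flow of `Φ`), the image of the centred
homogeneous local Gibbs law at temperature `θ` under the velocity scaling `v ↦ v/√θ` is the centred homogeneous local
Gibbs law at temperature `1`:
`(localGibbsLaw σ a 0 θ N Φ).map (scaleVel (√θ)⁻¹) = localGibbsLaw σ a 0 1 N Ψ`. Folklore (the Maxwellian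
`M_{1,0,θ}` is the image of `M_{1,0,1}` under `v ↦ √θ v`; positions and the hard-core factor are untouched). -/
def LocalGibbsLawThermalScaling : Prop :=
  ∀ (σ a θ : ℝ) (N : ℕ) (Φ Ψ : HardSphereFlow (Torus.geometry (Fin 3)) (hsDiameter σ N) (N + 1)), 0 < θ →
    (localGibbsLaw σ (fun _ => a) (fun _ => (0 : V3)) (fun _ => θ) N Φ).map (scaleVel (Real.sqrt θ)⁻¹) =
      localGibbsLaw σ (fun _ => a) (fun _ => (0 : V3)) (fun _ => (1 : ℝ)) N Ψ

/-- **Layer 3, proved**: `stub_localGibbsLawThermalScaling`. [folklore] -/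
theorem stub_localGibbsLawThermalScaling : LocalGibbsLawThermalScaling :=
  fun σ a _ N Φ Ψ hθ => localGibbsLaw_const_map_scaleVel_thermal_zero σ a hθ N Φ Ψ

end Summit.AtomisticToContinuum.HydrodynamicLimit.Theorems.KineticWindowGronwallThermalScaling

end
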